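import Summits.QuantumAdvantage.QuantumAdvantage.Statement
import Summits.QuantumAdvantage.QuantumAdvantage.Theorems.SoloBlindCeiling
import Literature.Computability.QuantumComplexity.BQTime
import Literature.Computability.Complexity.RelativizedTime
import HarnessLib

/-!
# `QuantumAdvantage`: the weakest quantum-retaining consequence, `BQTIME(quasipoly) ⊄ BPP`

Fourth companion of `SoloBlindCeiling.lean` (imports only that file). Every consequence of the
summit `BQP ⊄ BPP` recorded so far (`PP ⊄ BPP`, `PSPACE ⊄ BPP`, `EXP ⊄ BPP`, `NEXP ⊄ BPP`) forgets
the quantum computer and is itself a notorious open separation implying `P ≠ PSPACE` or at least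
`BPP ≠ NEXP`. This file isolates a consequence that keeps the quantum computer and provably does
NOT carry that curse:

  the rung  `BQQP ⊄ BPP`,  where `BQQP = ⋃ k, BQTIME(2^{(log₂ n)^k})`

(quantum quasi-polynomial time, description-uniform Clifford+T families in the tree's `BQTime`,
with the level functions `2 ^ (Nat.log 2 n) ^ k` of the tree's `NQP`; `BQQP` and the classical
`BPQP = ⋃ k, BPTIME(2^{(log₂ n)^k})` are local notations — the file adds no definitions).

Sorry-free content:

* `soloBlind_BQTime_pow_subset_qpLevel : BQTIME(n^k) ⊆ BQTIME(2^{(log₂ n)^{k+1}})` (the arithmetic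
  `n^k ≤ 2^{k(k+1)} · 2^{(log₂ n)^{k+1}}`), hence `soloBlind_BQP_subset_BQQP : BQP ⊆ BQQP`;
* `soloBlind_rung_of_summit : QuantumAdvantage → ¬ (BQQP ⊆ BPP)` — the summit implies the rung, so a
  refutation of the rung refutes the summit (`soloBlind_not_summit_of_BQQP_subset_BPP`);
* `soloBlind_rung_of_BPH : BPQP ⊆ BQQP → ¬ (BPQP ⊆ BPP) → ¬ (BQQP ⊆ BPP)` — the rung also follows
  from the (open, believed, classical) quasi-polynomial probabilistic time hierarchy `BPQP ⊄ BPP`,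
  given the simulation `BPQP ⊆ BQQP`;
* `soloBlind_rung_iff` — modulo three named folklore padding/simulation facts, carried as explicit
  hypothesis binders over an arbitrary padding map and not proved here (H↓ `hdown`: the
  quasi-polynomially padded version of a `BQTIME(2^{(log n)^k})` language is in `BQP`; H↑ `hup`: if
  that padded version is in `BPP` then the language is in `BPQP`; Hsim `hsim : BPQP ⊆ BQQP`), the
  rung is EXACTLY the disjunction `QuantumAdvantage ∨ (BPQP ⊄ BPP)`, and its failure is exactly the
  world `BQP ⊆ BPP ∧ BPQP ⊆ BPP` (`soloBlind_not_rung_iff`).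

Why this rung is the honest "next statement down". In print: `P = BPP` gives `BPQP ⊄ BPP`
by the deterministic time hierarchy, and so do `NP ⊆ BPP` / `Σ₂ᵖ ⊆ BPP` (then `BPP` is a syntactic
class) — so the rung holds in every world currently describable except `BQP = BPP ≠ P` with a
total collapse of quasi-polynomial probabilistic time to `BPP`; a uniform hierarchy for `BPTIME` (or
`BQTIME`) at quasi-polynomial gaps is open (Arora–Barak 2009, §7.5.3: "we are even unable to show
that, say, `BPTIME(n) ≠ BPTIME(n^{(log n)^{10}})`"), known only with one bit of advice (Barak 2002;
Fortnow–Santhanam 2004; for general semantic classes including `BQTIME` at quasi-polynomial gaps,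
Fortnow–Santhanam–Trevisan 2004, Thm. 2), and unconditionally only at gaps whose constant-fold
iterate leaves `2^{poly}` (Karpinski–Verbeek 1987). Unlike the summit, the rung is not refuted
relative to a `PSPACE`-complete oracle (there `DTIME^A(2^{(log n)^2}) ⊄ PSPACE = BPP^A`).

Nothing here is progress towards the summit; it types the weakest statement I can name that a
proof of the summit proves *a fortiori* while still mentioning quantum computation, and shows that
this statement is one padding argument away from a purely classical open hierarchy question.

References: S. Arora, B. Barak, *Computational Complexity: A Modern Approach* (2009), §7.5.3;
B. Barak, *A probabilistic-time hierarchy theorem for slightly non-uniform algorithms*, RANDOM 2002,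
LNCS 2483; L. Fortnow, R. Santhanam, *Hierarchy theorems for probabilistic polynomial time*, FOCS 2004;
L. Fortnow, R. Santhanam, L. Trevisan, *Promise hierarchies*, ECCC TR04-098 (2004) (= *Hierarchies for
semantic classes*, STOC 2005), Thms. 1–2; D. van Melkebeek, K. Pervyshev, *A generic time hierarchy for
semantic models with one bit of advice*, Dagstuhl Seminar Proceedings 06111 (2006), §1; M. Karpinski,
R. Verbeek, LNCS 270 (1987) 189–207; E. Bernstein, U. Vazirani, *Quantum complexity theory*, SIAM J.
Comput. 26 (1997), §8.1 (`BQTime(T(n))`).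
-/

namespace Summit.QuantumAdvantage.QuantumAdvantage.Theorems

open Literature.Computability.Complexity Literature.Computability.Complexity.Classes
  Literature.Computability.Cryptography Literature.Computability.QuantumComplexity

/-! ### The two quasi-polynomial classes (notations, so that the file adds no definitions)

`BQQP = ⋃ k, BQTIME(2^{(log₂ n)^k})` over the tree's description-uniform Clifford+T classes `BQTime`
(Bernstein–Vazirani 1997, §8.1) and `BPQP = ⋃ k, BPTIME(2^{(log₂ n)^k})` over the tree's `BPTime`
(Arora–Barak 2009, Def. 7.2), with the level functions `2 ^ (Nat.log 2 n) ^ k` of the tree's `NQP`. -/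

/-- `BQQP = BQTIME(quasipoly)` (local notation). -/
local notation "BQQP" => (⋃ k : ℕ, BQTime (fun n : ℕ => 2 ^ Nat.log 2 n ^ k))

/-- `BPQP = BPTIME(quasipoly)` (local notation). -/
local notation "BPQP" => (⋃ k : ℕ, BPTime (fun n : ℕ => 2 ^ Nat.log 2 n ^ k))

/-! ### The arithmetic: `n ^ k ≤ 2 ^ (k (k+1)) · 2 ^ (log₂ n) ^ (k+1)` -/

/-- `k (m + 1) ≤ m ^ (k+1) + k (k+1)` for all naturals (case split at `m = k + 1`). -/
theorem soloBlind_mul_succ_le_pow_add (k m : ℕ) : k * (m + 1) ≤ m ^ (k + 1) + k * (k + 1) := by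
  rcases Nat.eq_zero_or_pos k with hk | hk
  · subst hk; simp
  rcases Nat.lt_or_ge m (k + 1) with h | h
  · have : k * (m + 1) ≤ k * (k + 1) := Nat.mul_le_mul_left k (by omega)
    omega
  · have h1 : k * (m + 1) ≤ m * m := by nlinarith
    have h2 : m * m ≤ m ^ (k + 1) := by
      rw [← pow_two]
      exact Nat.pow_le_pow_right (by omega) (by omega)
    omega

/-- `n ^ k ≤ 2 ^ (k (k+1)) · 2 ^ (log₂ n) ^ (k+1)`: with `m = log₂ n`, `n < 2^{m+1}` gives
`n^k ≤ 2^{k(m+1)} ≤ 2^{m^{k+1} + k(k+1)}`. -/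
theorem soloBlind_pow_le_qpLevel (k n : ℕ) :
    n ^ k ≤ 2 ^ (k * (k + 1)) * 2 ^ Nat.log 2 n ^ (k + 1) := by
  have hn : n < 2 ^ (Nat.log 2 n + 1) := Nat.lt_pow_succ_log_self one_lt_two n
  calc n ^ k ≤ (2 ^ (Nat.log 2 n + 1)) ^ k := Nat.pow_le_pow_left hn.le k
    _ = 2 ^ (k * (Nat.log 2 n + 1)) := by rw [← pow_mul, Nat.mul_comm]
    _ ≤ 2 ^ (Nat.log 2 n ^ (k + 1) + k * (k + 1)) :=
        Nat.pow_le_pow_right two_pos (soloBlind_mul_succ_le_pow_add k (Nat.log 2 n))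
    _ = 2 ^ (k * (k + 1)) * 2 ^ Nat.log 2 n ^ (k + 1) := by rw [pow_add, Nat.mul_comm]

/-! ### `BQP ⊆ BQQP`; the summit implies the rung; the classical hierarchy implies the rung -/

/-- **`BQTIME(n^k) ⊆ BQTIME(2^{(log₂ n)^{k+1}})`**: a description budget `C n^k + C` is at most
`C' 2^{(log₂ n)^{k+1}} + C'` with `C' = C · 2^{k(k+1)}` (Bernstein–Vazirani 1997, §8.1, monotonicity). -/
theorem soloBlind_BQTime_pow_subset_qpLevel (k : ℕ) :
    BQTime (fun n => n ^ k) ⊆ BQTime (fun n => 2 ^ Nat.log 2 n ^ (k + 1)) := by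
  rintro L ⟨F, hF, ⟨C, hU⟩, hL⟩
  refine ⟨F, hF, ⟨C * 2 ^ (k * (k + 1)), hU.mono fun n => ?_⟩, hL⟩
  dsimp only
  have h := Nat.mul_le_mul_left C (soloBlind_pow_le_qpLevel k n)
  have h1 : C ≤ C * 2 ^ (k * (k + 1)) := Nat.le_mul_of_pos_right C Nat.one_le_two_pow
  calc C * n ^ k + C
      ≤ C * (2 ^ (k * (k + 1)) * 2 ^ Nat.log 2 n ^ (k + 1)) + C * 2 ^ (k * (k + 1)) :=
        add_le_add h h1
    _ = C * 2 ^ (k * (k + 1)) * 2 ^ Nat.log 2 n ^ (k + 1) + C * 2 ^ (k * (k + 1)) := by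
        rw [Nat.mul_assoc]

/-- **`BQP ⊆ BQQP = BQTIME(quasipoly)`**: `BQP = ⋃ k, BQTIME(n^k)` (tree: `BQP_subset_iUnion_BQTime_pow`)
and each slice lies in the next quasi-polynomial level. -/
theorem soloBlind_BQP_subset_BQQP : BQP ⊆ BQQP := by
  intro L hL
  obtain ⟨k, hk⟩ := Set.mem_iUnion.1 (BQP_subset_iUnion_BQTime_pow hL)
  exact Set.mem_iUnion.2 ⟨k + 1, soloBlind_BQTime_pow_subset_qpLevel k hk⟩

/-- **Summit ⇒ rung**: `BQP ⊄ BPP → BQTIME(quasipoly) ⊄ BPP`. The rung `BQQP ⊄ BPP` is open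
(Arora–Barak 2009, §7.5.3; with one bit of advice it is a theorem: Fortnow–Santhanam–Trevisan 2004,
Thm. 2 with `CTIME = BQTIME`). -/
theorem soloBlind_rung_of_summit (h : _root_.QuantumAdvantage) : ¬ (BQQP ⊆ BPP) :=
  fun hsub => soloBlind_quantumAdvantage_iff_not_subset.1 h (soloBlind_BQP_subset_BQQP.trans hsub)

/-- The rung in witness form: the summit puts some language of `BQTIME(quasipoly)` outside `BPP`. -/
theorem soloBlind_rung_witness_of_summit (h : _root_.QuantumAdvantage) : ∃ L ∈ BQQP, L ∉ BPP :=
  Set.not_subset.1 (soloBlind_rung_of_summit h)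

/-- Kill switch: a collapse `BQTIME(quasipoly) ⊆ BPP` refutes the summit. -/
theorem soloBlind_not_summit_of_BQQP_subset_BPP (h : BQQP ⊆ BPP) : ¬ _root_.QuantumAdvantage :=
  fun hq => soloBlind_rung_of_summit hq h

/-- **Classical hierarchy ⇒ rung**: the (open; Arora–Barak 2009, §7.5.3: "we are even unable to show
that, say, `BPTIME(n) ≠ BPTIME(n^{(log n)^{10}})`") quasi-polynomial probabilistic time hierarchy
`BPQP ⊄ BPP` gives the rung, granted the simulation `BPTIME(quasipoly) ⊆ BQTIME(quasipoly)`
(Bernstein–Vazirani 1997, §8.1–8.2; the tree proves the polynomial level `BPP ⊆ BQP`). -/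
theorem soloBlind_rung_of_BPH (hsim : BPQP ⊆ BQQP) (h : ¬ (BPQP ⊆ BPP)) : ¬ (BQQP ⊆ BPP) :=
  fun hsub => h (hsim.trans hsub)

/-! ### The rung is exactly `Summit ∨ classical quasi-polynomial hierarchy`, modulo the padding dictionary

The three folklore facts are carried as explicit hypothesis binders over an ARBITRARY padding map
`pad : ℕ → List Bool → List Bool` (intended instance: `pad k x = x ++ 1 0^{(|x|+1)·2^{(log₂|x|)^k} − |x| − 1}`,
whose padded length `(n+1)·2^{(log₂ n)^k}` is strictly increasing in `n`, so it determines `n`):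

* **(H↓) padding down** `hdown : ∀ k L, L ∈ BQTIME(2^{(log₂ n)^k}) → pad k '' L ∈ BQP` — on a padded
  input of length `N ≥ 2^{(log₂ n)^k}` the circuit for `L` has a `poly(N)`-time description and the pad
  format is checked reversibly (Arora–Barak 2009, §2.6 "padding"; Bernstein–Vazirani 1997, §8.1);
* **(H↑) padding up** `hup : ∀ k L, pad k '' L ∈ BPP → L ∈ BPQP` — write the pad and run the `BPP`
  machine: time and coins `poly((n+1) 2^{(log₂ n)^k}) ≤ c · 2^{(log₂ n)^{k+1}} + c` (Arora–Barak 2009,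
  §2.6 and Def. 7.2);
* **(Hsim)** `hsim : BPQP ⊆ BQQP`.

None of the three is proved in this file (each is a machine/circuit construction over the tree's
`BPTime` / `BQTime`); the theorems below are the logic of the padding argument, kernel-checked. -/

/-- **Rung ∧ ¬Summit ⇒ classical hierarchy** (modulo H↓, H↑): if `BQP ⊆ BPP` then every
`L ∈ BQTIME(2^{(log n)^k})` pads down into `BQP ⊆ BPP` and unpads into `BPTIME(quasipoly)`, so a
collapse `BPQP ⊆ BPP` would give `BQQP ⊆ BPP`. -/
theorem soloBlind_BPH_of_rung_of_not_summit (pad : ℕ → List Bool → List Bool)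
    (hdown : ∀ (k : ℕ) (L : Language Bool),
      L ∈ BQTime (fun n => 2 ^ Nat.log 2 n ^ k) → pad k '' (L : Set (List Bool)) ∈ BQP)
    (hup : ∀ (k : ℕ) (L : Language Bool), pad k '' (L : Set (List Bool)) ∈ BPP → L ∈ BPQP)
    (hS : ¬ (BQQP ⊆ BPP)) (hns : ¬ _root_.QuantumAdvantage) : ¬ (BPQP ⊆ BPP) := by
  have hBQP : BQP ⊆ BPP := by
    by_contra h'
    exact hns (soloBlind_quantumAdvantage_iff_not_subset.2 h')
  intro hBPQP
  apply hS
  intro L hL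
  obtain ⟨k, hk⟩ := Set.mem_iUnion.1 hL
  exact hBPQP (hup k L (hBQP (hdown k L hk)))

/-- **The dichotomy** (modulo H↓, H↑): the rung implies `Summit ∨ (BPQP ⊄ BPP)`. -/
theorem soloBlind_summit_or_BPH_of_rung (pad : ℕ → List Bool → List Bool)
    (hdown : ∀ (k : ℕ) (L : Language Bool),
      L ∈ BQTime (fun n => 2 ^ Nat.log 2 n ^ k) → pad k '' (L : Set (List Bool)) ∈ BQP)
    (hup : ∀ (k : ℕ) (L : Language Bool), pad k '' (L : Set (List Bool)) ∈ BPP → L ∈ BPQP)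
    (hS : ¬ (BQQP ⊆ BPP)) : _root_.QuantumAdvantage ∨ ¬ (BPQP ⊆ BPP) := by
  by_cases hq : _root_.QuantumAdvantage
  · exact Or.inl hq
  · exact Or.inr (soloBlind_BPH_of_rung_of_not_summit pad hdown hup hS hq)

/-- **Characterisation** (modulo H↓, H↑, Hsim):
`BQTIME(quasipoly) ⊄ BPP  ↔  (BQP ⊄ BPP) ∨ (BPTIME(quasipoly) ⊄ BPP)`. -/
theorem soloBlind_rung_iff (pad : ℕ → List Bool → List Bool)
    (hdown : ∀ (k : ℕ) (L : Language Bool),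
      L ∈ BQTime (fun n => 2 ^ Nat.log 2 n ^ k) → pad k '' (L : Set (List Bool)) ∈ BQP)
    (hup : ∀ (k : ℕ) (L : Language Bool), pad k '' (L : Set (List Bool)) ∈ BPP → L ∈ BPQP)
    (hsim : BPQP ⊆ BQQP) :
    ¬ (BQQP ⊆ BPP) ↔ (_root_.QuantumAdvantage ∨ ¬ (BPQP ⊆ BPP)) := by
  constructor
  · exact soloBlind_summit_or_BPH_of_rung pad hdown hup
  · rintro (hq | hb)
    · exact soloBlind_rung_of_summit hq
    · exact soloBlind_rung_of_BPH hsim hb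

/-- **The uncovered world** (modulo H↓, H↑, Hsim): the rung fails exactly when `BQP ⊆ BPP` AND
quasi-polynomial probabilistic time collapses to `BPP`. -/
theorem soloBlind_not_rung_iff (pad : ℕ → List Bool → List Bool)
    (hdown : ∀ (k : ℕ) (L : Language Bool),
      L ∈ BQTime (fun n => 2 ^ Nat.log 2 n ^ k) → pad k '' (L : Set (List Bool)) ∈ BQP)
    (hup : ∀ (k : ℕ) (L : Language Bool), pad k '' (L : Set (List Bool)) ∈ BPP → L ∈ BPQP)
    (hsim : BPQP ⊆ BQQP) :
    ¬ ¬ (BQQP ⊆ BPP) ↔ (BQP ⊆ BPP ∧ BPQP ⊆ BPP) := by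
  rw [soloBlind_rung_iff pad hdown hup hsim, not_or, soloBlind_quantumAdvantage_iff_not_subset]
  simp only [not_not]

end Summit.QuantumAdvantage.QuantumAdvantage.Theorems
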